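import Mathlib
import Summits.Ventures.PercRepro2.V2SeriesClosure
import Summits.Ventures.PercRepro2.V2ParallelClosure

/-!
# The Hall form (V2) of (U) holds on every series–parallel network
(seat mine-b, cell pub-perc-repro2; conjectures/MINE-B.md §19)

Series–parallel two-terminal networks are built from the three atoms — a free edge (two
configurations `red < blue`, flows `(1,0)` and `(0,1)`), a pinned edge (one configuration, flows
`(1,1)`) and an absent edge (flows `(0,0)`) — by series and parallel composition; the configuration
poset of a composition is the product poset of the parts and the flows compose by minima (series,
Menger at the glued terminal) and sums (parallel).  `V2SeriesClosure.lean` and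
`V2ParallelClosure.lean` show that the conjunction of the Hall form (V2) and the Harris condition
(HC) is preserved by both compositions; the atoms satisfy both; hence

  `SP.upDom : ∀ s : SP, UpDom s.rLab s.bLab`

— every upper set of the configuration poset of every series–parallel pattern carries non-negative
`ν′`-mass; by the colour swap and Hall's theorem, every configuration with `F_R = 0`, `F_B = a ≥ 2`
owns `a` private configurations below it with `F_B = 1`, `F_R ≥ 1` (and, summing, the count (U) of
`FlowSumClosure.lean`).
-/

namespace Summit.Ventures.PercRepro2.V2Closure

open Finset

/-- Series–parallel two-terminal networks over the three atoms. -/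
inductive SP : Type
  | free : SP
  | pin : SP
  | absent : SP
  | ser : SP → SP → SP
  | par : SP → SP → SP

/-- The configuration type of a network: a free edge has two states (`false` = red, `true` = blue),
a pinned or absent edge has one, and a composition has the product. -/
def SP.Conf : SP → Type
  | .free => Bool
  | .pin => Unit
  | .absent => Unit
  | .ser s t => s.Conf × t.Conf
  | .par s t => s.Conf × t.Conf

/-- The configuration preorder: `red < blue` on a free edge, products for compositions. -/
@[reducible] def SP.confPreorder : ∀ s : SP, Preorder s.Conf
  | .free => inferInstanceAs (Preorder Bool)
  | .pin => inferInstanceAs (Preorder Unit)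
  | .absent => inferInstanceAs (Preorder Unit)
  | .ser s t =>
      let _ := s.confPreorder
      let _ := t.confPreorder
      inferInstanceAs (Preorder (s.Conf × t.Conf))
  | .par s t =>
      let _ := s.confPreorder
      let _ := t.confPreorder
      inferInstanceAs (Preorder (s.Conf × t.Conf))

/-- The configuration type is finite. -/
@[reducible] def SP.confFintype : ∀ s : SP, Fintype s.Conf
  | .free => inferInstanceAs (Fintype Bool)
  | .pin => inferInstanceAs (Fintype Unit)
  | .absent => inferInstanceAs (Fintype Unit)
  | .ser s t =>
      let _ := s.confFintype
      let _ := t.confFintype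
      inferInstanceAs (Fintype (s.Conf × t.Conf))
  | .par s t =>
      let _ := s.confFintype
      let _ := t.confFintype
      inferInstanceAs (Fintype (s.Conf × t.Conf))

/-- Configurations have decidable equality. -/
@[reducible] def SP.confDecEq : ∀ s : SP, DecidableEq s.Conf
  | .free => inferInstanceAs (DecidableEq Bool)
  | .pin => inferInstanceAs (DecidableEq Unit)
  | .absent => inferInstanceAs (DecidableEq Unit)
  | .ser s t =>
      let _ := s.confDecEq
      let _ := t.confDecEq
      inferInstanceAs (DecidableEq (s.Conf × t.Conf))
  | .par s t =>
      let _ := s.confDecEq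
      let _ := t.confDecEq
      inferInstanceAs (DecidableEq (s.Conf × t.Conf))

/-- The configuration preorder, as an instance. -/
instance (s : SP) : Preorder s.Conf := s.confPreorder

/-- Finiteness of the configurations, as an instance. -/
instance (s : SP) : Fintype s.Conf := s.confFintype

/-- Decidable equality of configurations, as an instance. -/
instance (s : SP) : DecidableEq s.Conf := s.confDecEq

/-- The red flow of a configuration: `1` on a red free edge, `1` on a pin, minima / sums. -/
def SP.rLab : ∀ s : SP, s.Conf → ℕ
  | .free => fun (c : Bool) => if c then 0 else 1
  | .pin => fun _ => 1
  | .absent => fun _ => 0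
  | .ser s t => serR s.rLab t.rLab
  | .par s t => parR s.rLab t.rLab

/-- The blue flow of a configuration: `1` on a blue free edge, `1` on a pin, minima / sums. -/
def SP.bLab : ∀ s : SP, s.Conf → ℕ
  | .free => fun (c : Bool) => if c then 1 else 0
  | .pin => fun _ => 1
  | .absent => fun _ => 0
  | .ser s t => serB s.bLab t.bLab
  | .par s t => parB s.bLab t.bLab

/-- A sum over a finset of booleans, written out. -/
theorem sum_bool_eq (V : Finset Bool) (f : Bool → ℤ) :
    ∑ c ∈ V, f c = (if true ∈ V then f true else 0) + (if false ∈ V then f false else 0) := by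
  rw [← Finset.univ_inter V, ← Finset.sum_ite_mem, Fintype.sum_bool]
  simp

/-- The red label of a free edge, as a function on `Bool`. -/
def freeR (c : Bool) : ℕ := if c then 0 else 1

/-- The blue label of a free edge, as a function on `Bool`. -/
def freeB (c : Bool) : ℕ := if c then 1 else 0

/-- (V2) on a free edge: `ν′` vanishes on both states. -/
theorem free_upDom' : UpDom freeR freeB := by
  intro V _
  apply Finset.sum_nonneg
  intro c _
  cases c <;> simp [nu', freeR, freeB]

/-- (HC) on a free edge: an upper set containing the red state contains the blue one. -/
theorem free_harris' : HarrisCond freeR freeB := by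
  intro V hV
  rw [sum_bool_eq, sum_bool_eq]
  simp only [freeR, freeB]
  by_cases hf : false ∈ V
  · have ht : true ∈ V := hV (show false ≤ true by decide) hf
    simp [hf, ht]
  · simp only [hf, if_false, add_zero]
    split_ifs <;> omega

/-- (V2) on a free edge. -/
theorem free_upDom : UpDom SP.free.rLab SP.free.bLab := free_upDom'

/-- (HC) on a free edge. -/
theorem free_harris : HarrisCond SP.free.rLab SP.free.bLab := free_harris'

/-- (V2) on a pinned edge: the single state has `ν′ = 1`. -/
theorem pin_upDom : UpDom SP.pin.rLab SP.pin.bLab := by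
  intro V _
  apply Finset.sum_nonneg
  intro c _
  simp [nu', SP.rLab, SP.bLab]

/-- (HC) on a pinned edge: both counts vanish. -/
theorem pin_harris : HarrisCond SP.pin.rLab SP.pin.bLab := by
  intro V _
  simp [SP.rLab, SP.bLab]

/-- (V2) on an absent edge: `ν′ = 0`. -/
theorem absent_upDom : UpDom SP.absent.rLab SP.absent.bLab := by
  intro V _
  apply Finset.sum_nonneg
  intro c _
  simp [nu', SP.rLab, SP.bLab]

/-- (HC) on an absent edge: both counts agree. -/
theorem absent_harris : HarrisCond SP.absent.rLab SP.absent.bLab := by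
  intro V _
  simp [SP.rLab, SP.bLab]

/-- **(V2) and (HC) hold on every series–parallel network** (induction over the network; the
closure theorems `upDom_ser`, `upDom_par`, `harris_ser`, `harris_par`). -/
theorem SP.upDom_and_harris : ∀ s : SP, UpDom s.rLab s.bLab ∧ HarrisCond s.rLab s.bLab
  | .free => ⟨free_upDom, free_harris⟩
  | .pin => ⟨pin_upDom, pin_harris⟩
  | .absent => ⟨absent_upDom, absent_harris⟩
  | .ser s t =>
      ⟨upDom_ser s.rLab s.bLab t.rLab t.bLab (SP.upDom_and_harris s).1 (SP.upDom_and_harris t).1,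
       harris_ser s.rLab s.bLab t.rLab t.bLab (SP.upDom_and_harris s).2 (SP.upDom_and_harris t).2⟩
  | .par s t =>
      ⟨upDom_par s.rLab s.bLab t.rLab t.bLab (SP.upDom_and_harris s).1 (SP.upDom_and_harris t).1
          (SP.upDom_and_harris s).2 (SP.upDom_and_harris t).2,
       harris_par s.rLab s.bLab t.rLab t.bLab (SP.upDom_and_harris s).2 (SP.upDom_and_harris t).2⟩

/-- **The Hall form (V2) of (U) holds on every series–parallel pattern**: every upper set of the
configuration poset carries non-negative `ν′`-mass. -/
theorem SP.upDom (s : SP) : UpDom s.rLab s.bLab := (SP.upDom_and_harris s).1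

/-- The count (U′) of a series–parallel pattern is non-negative (the upper set `univ`). -/
theorem SP.sum_nu'_nonneg (s : SP) : 0 ≤ ∑ c, nu' s.rLab s.bLab c :=
  SP.upDom s univ (by simp [isUpperSet_univ])

end Summit.Ventures.PercRepro2.V2Closure
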